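import Literature.MathematicalPhysics.QuantumManyBody.LiebSimpleEquation
import Mathlib.MeasureTheory.Constructions.HaarToSphere
import Mathlib.MeasureTheory.Measure.Lebesgue.VolumeOfBalls
import Mathlib.Analysis.SpecialFunctions.Gamma.Basic
import HarnessLib

/-!
# Lieb's simple equation (Carlen–Jauslin–Lieb): `∫ Y_c = 1/c` and `∫ u = 1/ρ`

Topic: `Literature/MathematicalPhysics/QuantumManyBody`. Proved statements about the objects of
`LiebSimpleEquation.lean` (definition request `defn-LiebSimpleEquation`), following the printed
two-line arguments of CJL-I = Carlen–Jauslin–Lieb, Pure Appl. Anal. 2 (2020), arXiv:1912.04987: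

* `integral_yukawa` — `∫_{ℝ³} Y_c(x) dx = 1/c` for `c > 0` (CJL-I after (1.8): "`Y_{4e}` is
  non-negative and `∫Y_{4e} dx = (4e)⁻¹`"), by polar coordinates (Mathlib
  `integral_fun_norm_addHaar`, `|B₁| = 4π/3`, `∫₀^∞ s e^{−√c s} ds = Γ(2)/c`); `integrable_yukawa`.
* `IsSolution.integral_eq` — **`∫u = 1/ρ` for every solution** (CJL-I (1.6) "the system (1.1)–(1.2)
  is actually equivalent to (1.1) and the constraint `∫u dx = 1/ρ`", proof (1.11); CJL-II (1.21)
  "(intu)"): integrating the mild form (1.10) gives `∫u = (4e)⁻¹∫𝒱(1 − u) + (ρ/2)(∫u)²`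
  (`∫u∗u = (∫u)²`, Mathlib `integral_convolution`), and the energy constraint
  `∫𝒱(1 − u) = 2e/ρ` turns this into `(ρ∫u − 1)² = 0`.
* `IsSolution.two_mul_le` — the elementary half `2e ≤ ρ∫𝒱` of CJL-I (1.21)
  (`e = (ρ/2)∫(1 − u)𝒱 ≤ (ρ/2)∫𝒱` as `u, 𝒱 ≥ 0`).

## References

* [CarlenJauslinLieb2020] E. A. Carlen, I. Jauslin, E. H. Lieb, *Analysis of a simple equation for
  the ground state energy of the Bose gas*, Pure Appl. Anal. 2 (2020) 659–684, arXiv:1912.04987: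
  (1.6), (1.8)–(1.11), (1.21).
* [CarlenJauslinLieb2021] E. A. Carlen, I. Jauslin, E. H. Lieb, *… II*, SIAM J. Math. Anal. 53
  (2021) 5322–5360, arXiv:2010.13882: (1.21) (intu).
-/

noncomputable section

open MeasureTheory Filter Set
open scoped ENNReal Topology

namespace Literature.MathematicalPhysics.QuantumManyBody

namespace LiebSimpleEquation

open BoseGas (Space)

/-! ## The Yukawa potential integrates to `1/c` -/

/-- The radial integral behind `∫ Y_c`: `∫_{(0,∞)} s² · e^{−√c s}/(4πs) ds = (4π)⁻¹ c⁻¹`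
(`∫₀^∞ s e^{−√c s} ds = Γ(2)/c`). [cite: CarlenJauslinLieb2020, (1.8)–(1.9)] -/
theorem setIntegral_yukawa_radial {c : ℝ} (hc : 0 < c) :
    ∫ s in Ioi (0 : ℝ), s ^ (3 - 1) • (Real.exp (-(Real.sqrt c * s)) / (4 * Real.pi * s)) =
      (4 * Real.pi)⁻¹ * (1 / c) := by
  have h1 : EqOn (fun s : ℝ => s ^ (3 - 1) • (Real.exp (-(Real.sqrt c * s)) / (4 * Real.pi * s)))
      (fun s => (4 * Real.pi)⁻¹ * (s ^ ((2 : ℝ) - 1) * Real.exp (-(Real.sqrt c * s)))) (Ioi 0) := by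
    intro s hs
    have hs0 : (s : ℝ) ≠ 0 := ne_of_gt hs
    have hpi : Real.pi ≠ 0 := Real.pi_ne_zero
    simp only [smul_eq_mul]
    rw [show (2 : ℝ) - 1 = 1 by norm_num, Real.rpow_one]
    field_simp
  rw [setIntegral_congr_fun measurableSet_Ioi h1, integral_const_mul,
    Real.integral_rpow_mul_exp_neg_mul_Ioi (by norm_num : (0 : ℝ) < 2) (Real.sqrt_pos.2 hc)]
  have hG : Real.Gamma 2 = 1 := by
    rw [show (2 : ℝ) = 1 + 1 by norm_num, Real.Gamma_add_one one_ne_zero, Real.Gamma_one, mul_one]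
  rw [hG, mul_one, Real.rpow_two, one_div, inv_pow, Real.sq_sqrt hc.le, one_div]

/-- **`∫_{ℝ³} Y_c(x) dx = 1/c` for `c > 0`** (CJL-I after (1.8): "`Y_{4e}` is non-negative and
`∫ Y_{4e} dx = (4e)⁻¹`"), by polar coordinates (Mathlib `integral_fun_norm_addHaar`,
`|B₁| = 4π/3`). [cite: CarlenJauslinLieb2020, (1.8)–(1.9)] -/
theorem integral_yukawa {c : ℝ} (hc : 0 < c) : ∫ x, yukawa c x = 1 / c := by
  have h := integral_fun_norm_addHaar (volume : Measure Space)
    (fun s : ℝ => Real.exp (-(Real.sqrt c * s)) / (4 * Real.pi * s))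
  simp only [finrank_euclideanSpace_fin] at h
  change ∫ x : Space, Real.exp (-(Real.sqrt c * ‖x‖)) / (4 * Real.pi * ‖x‖) = 1 / c
  rw [h, setIntegral_yukawa_radial hc, measureReal_def, EuclideanSpace.volume_ball_fin_three,
    ENNReal.toReal_mul, ← ENNReal.ofReal_pow zero_le_one, one_pow, ENNReal.toReal_ofReal zero_le_one,
    ENNReal.toReal_ofReal (by positivity : (0 : ℝ) ≤ Real.pi * 4 / 3)]
  simp only [nsmul_eq_mul, smul_eq_mul]
  have hpi : Real.pi ≠ 0 := Real.pi_ne_zero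
  field_simp
  ring

/-- `Y_c` is integrable on `ℝ³` for `c > 0`. [cite: CarlenJauslinLieb2020, (1.8)–(1.9)] -/
theorem integrable_yukawa {c : ℝ} (hc : 0 < c) : Integrable (yukawa c) := by
  refine Integrable.of_integral_ne_zero ?_
  rw [integral_yukawa hc]
  positivity

/-! ## `∫ u = 1/ρ` -/

/-- For a solution `u` (`0 ≤ u ≤ 1`) and integrable `𝒱`, `(1 − u)𝒱` is integrable.
[cite: CarlenJauslinLieb2020, (1.10)–(1.11)] -/
theorem IsSolution.integrable_one_sub_mul {𝒱 : Space → ℝ} {ρ e : ℝ} {u : Space → ℝ}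
    (hu : IsSolution 𝒱 ρ e u) (h1 : Integrable 𝒱) : Integrable fun y => (1 - u y) * 𝒱 y := by
  refine h1.bdd_mul (c := 1) ?_ (Eventually.of_forall fun x => ?_)
  · exact aestronglyMeasurable_const.sub hu.integrable.aestronglyMeasurable
  · have := hu.nonneg x
    have := hu.le_one x
    rw [Real.norm_eq_abs, abs_le]
    constructor <;> linarith

/-- For integrable `u`, `u∗u` is integrable and `∫ u∗u = (∫u)²` (Fubini; Mathlib
`integral_convolution`). [folklore] -/
theorem integral_conv_self {u : Space → ℝ} (hu : Integrable u) :
    Integrable (conv u u) ∧ ∫ x, conv u u x = (∫ x, u x) ^ 2 := by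
  refine ⟨hu.integrable_convolution (ContinuousLinearMap.mul ℝ ℝ) hu, ?_⟩
  rw [conv, integral_convolution (ContinuousLinearMap.mul ℝ ℝ) hu hu]
  simp [sq]

/-- **`∫ u = 1/ρ` for every solution of the simple equation** (CJL-I (1.6): "the system
(1.1)–(1.2) is actually equivalent to (1.1) and the constraint `∫u(x)dx = 1/ρ`"; CJL-II (1.21)
"(intu)": "integrating both sides of the simple equation, one sees that all solutions of the system
satisfy `∫u dx = 1/ρ`"). Proof as printed (CJL-I (1.11)): integrating the mild form (1.10) gives
`∫u = (4e)⁻¹∫𝒱(1 − u) + (ρ/2)(∫u)²`; with the energy constraint `∫𝒱(1 − u) = 2e/ρ` this is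
`(ρ∫u − 1)² = 0`. Hypotheses: `𝒱` integrable, `ρ, e > 0`. [cite: CarlenJauslinLieb2020, (1.6) and (1.11)] -/
theorem IsSolution.integral_eq {𝒱 : Space → ℝ} {ρ e : ℝ} {u : Space → ℝ} (hu : IsSolution 𝒱 ρ e u)
    (h1 : Integrable 𝒱) (hρ : 0 < ρ) (he : 0 < e) : ∫ x, u x = 1 / ρ := by
  set F : Space → ℝ := fun y => (1 - u y) * 𝒱 y + 2 * e * ρ * conv u u y with hF
  have hVu := hu.integrable_one_sub_mul h1
  obtain ⟨huu, hIuu⟩ := integral_conv_self hu.integrable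
  have hFint : Integrable F := hVu.add (huu.const_mul (2 * e * ρ))
  have hY : Integrable (yukawa (4 * e)) := integrable_yukawa (by positivity)
  have hIu : ∫ x, u x = 1 / (4 * e) * ∫ y, F y := by
    rw [integral_congr_ae (Eventually.of_forall hu.mild : (fun x => u x) =ᵐ[volume]
      fun x => conv (yukawa (4 * e)) F x)]
    change ∫ x, conv (yukawa (4 * e)) F x = _
    rw [conv, integral_convolution (ContinuousLinearMap.mul ℝ ℝ) hY hFint,
      ContinuousLinearMap.mul_apply', integral_yukawa (by positivity)]
  have hIF : ∫ y, F y = (∫ y, (1 - u y) * 𝒱 y) + 2 * e * ρ * (∫ x, u x) ^ 2 := by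
    rw [hF, integral_add hVu (huu.const_mul _), integral_const_mul, hIuu]
  have hE : ∫ y, (1 - u y) * 𝒱 y = 2 * e / ρ := by
    have h := hu.energy
    unfold EnergyConstraint at h
    field_simp
    linarith
  set X := ∫ x, u x with hX
  have hmain : X = 1 / (4 * e) * (2 * e / ρ + 2 * e * ρ * X ^ 2) := by
    rw [← hE, ← hIF]; exact hIu
  have hpoly : 4 * e * ρ * X = 2 * e + 2 * e * ρ ^ 2 * X ^ 2 := by
    have he0 : e ≠ 0 := he.ne'
    have hρ0 : ρ ≠ 0 := hρ.ne'
    calc 4 * e * ρ * X = 4 * e * ρ * (1 / (4 * e) * (2 * e / ρ + 2 * e * ρ * X ^ 2)) := by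
          rw [← hmain]
      _ = 2 * e + 2 * e * ρ ^ 2 * X ^ 2 := by
          field_simp
  have h2 : 2 * ρ * X = 1 + ρ ^ 2 * X ^ 2 :=
    mul_left_cancel₀ (a := 2 * e) (by positivity)
      (show 2 * e * (2 * ρ * X) = 2 * e * (1 + ρ ^ 2 * X ^ 2) by linear_combination hpoly)
  have hsq : (ρ * X - 1) ^ 2 = 0 := by linear_combination -h2
  have hlin : ρ * X - 1 = 0 := pow_eq_zero_iff two_ne_zero |>.mp hsq
  field_simp
  linarith

/-! ## The elementary half of CJL-I (1.21) -/

/-- **`2e ≤ ρ∫𝒱`** for a solution at `(ρ, e)` with `ρ ≥ 0`, `𝒱 ≥ 0` integrable (from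
`e = (ρ/2)∫(1 − u)𝒱` and `0 ≤ u`; the printed `2e/‖𝒱‖₁ ≤ ρ` of CJL-I (1.21)).
[cite: CarlenJauslinLieb2020, (1.21)] -/
theorem IsSolution.two_mul_le {𝒱 : Space → ℝ} {ρ e : ℝ} {u : Space → ℝ} (hu : IsSolution 𝒱 ρ e u)
    (h0 : ∀ x, 0 ≤ 𝒱 x) (h1 : Integrable 𝒱) (hρ : 0 ≤ ρ) :
    2 * e ≤ ρ * ∫ x, 𝒱 x := by
  have hint : Integrable (fun x => (1 - u x) * 𝒱 x) := hu.integrable_one_sub_mul h1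
  have hle : ∫ x, (1 - u x) * 𝒱 x ≤ ∫ x, 𝒱 x := by
    refine integral_mono hint h1 fun x => ?_
    have := hu.nonneg x
    have := h0 x
    nlinarith
  have hE : e = ρ / 2 * ∫ x, (1 - u x) * 𝒱 x := hu.energy
  rw [hE]
  nlinarith [mul_le_mul_of_nonneg_left hle hρ]

/-- With `ρ > 0`: `2e/ρ ≤ ∫𝒱`, i.e. `∫(1 − u)𝒱 ≤ ∫𝒱` in the form CJL-II (1.1) uses
(`2e/ρ = ∫(1 − u)v`). [cite: CarlenJauslinLieb2020, (1.21)] -/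
theorem IsSolution.two_mul_div_le {𝒱 : Space → ℝ} {ρ e : ℝ} {u : Space → ℝ}
    (hu : IsSolution 𝒱 ρ e u) (h0 : ∀ x, 0 ≤ 𝒱 x) (h1 : Integrable 𝒱) (hρ : 0 < ρ) :
    2 * e / ρ ≤ ∫ x, 𝒱 x := by
  rw [div_le_iff₀ hρ, mul_comm (∫ x, 𝒱 x) ρ]
  exact hu.two_mul_le h0 h1 hρ.le

end LiebSimpleEquation

end Literature.MathematicalPhysics.QuantumManyBody

end
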